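import Mathlib

/-!
# `Balaban1983to89.B3Sect2Statements` — T. Bałaban, *(Higgs)₂,₃ quantum fields in a finite volume. III. Renormalization*,
Commun. Math. Phys. **88** (1983) 411–445 [Balaban1983Higgs3]: Sect. 2 "Classification of Divergent Graphs and Their
Renormalization" — the degree of a vertex (2.1), the printed table (i)–(v) p. 423, the degree of a graph (2.2)–(2.3), the degree
of the graph (2.4), the summation step of p. 427, the estimate (2.17) and **Corollary 2.3** (p. 429)

statement-level skeleton of published theorems with citation tags; proofs where landed; nothing here is a claim about the Yang–Mills mass gap

PDF held: `paper:balaban1983-higgs-2-3-quantum-fields-finite-volume` (journal page = PDF page + 410).  Renders read as images for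
every quotation below: `run/shared/lean/pub/pub-balaban/b2b-balaban-ref1/pages/1983-cmp88-higgs23-III/1983-cmp88-higgs23-III-p012,
p013, p014, p017, p018, p019-x4.png` (journal pp. 422, 423, 424, 427, 428, 429).

CITATION HEADER (lean-in-tree rule).  This module is part of the lit-balaban TYPED SKELETON (HOME `run/shared/lean/pub/lit-balaban/`,
rows B3-13, B3-14, B3-16, B3-20, B3-21, B3-23 of `HOME/lit-balaban-r15/SKELETON-r15.md`).  WHAT IS REPRODUCED, and how:
(a) the DEFINITIONS (2.1) (degree D_G(v) of a vertex in a graph), "D(v)" (the same count assuming all elements internal), (2.2) and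
(2.3) (degree of a connected graph) as real definitions with bodies, over explicit count data (`VertexCounts`: factors η, scalar
legs, A′-legs, differentiations, the flag "of the form (1.14)–(1.15)"; `Incidence`: how many of those legs/differentiations belong
to internal lines of G) — the printed dimension bookkeeping of p. 422 ("the dimension of a leg of scalar or vector field is equal to
−(d−2)/2, … A dimension of differentiation is −1, each factor η has a dimension +1 and external fields have a dimension equal to
0"); (b) KERNEL-CHECKED: the five printed evaluations (i)–(v) p. 423 of D(v) on the vertex catalogue (1.6)–(1.15) from its counts
(`degree_v16` … `degree_v1315`), the printed consequence "Thus for all vertices we have D(v) ≥ (4−d)/2" for 2 ≤ d ≤ 4 under the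
printed side conditions, the printed remark "D_G(v) ≥ D(v), except for the vertices (1.14) and (1.15)" (with the exception
WITNESSED: `degreeIn_lt_degree_averaging`), the degree 0 of the graph (2.4) under the reading stated at `degree_graph24`, the
summation step of p. 427 (`sum_scalePow_le`: Σ_{j=0}^{J}(L^jη)^D ≤ (1 − L^{−D})^{−1}(L^Jη)^D for D > 0, L > 1 — "Because D(G₁) > 0
we can make the summation over j"), and the arithmetic of the right side of (2.17) in d = 3; (c) as `def … : Prop` over an abstract
carrier `GraphFamily` (graphs with their numbers of vertices and external legs, their degree, and the three printed vertex
predicates): the estimate **(2.17)** and **Corollary 2.3**, verbatim.  Self-contained (imports Mathlib only): the same counts are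
carried by `…Balaban1983to89.B3Prop1.VertexKind` (filed in parallel); the bridge `VertexKind ↦ VertexCounts` is one line for the
instantiating seat and is deliberately not duplicated here.  NOTHING of the paper is asserted beyond the kernel-checked arithmetic:
`Ineq217`, `Cor23` are hypotheses for consumers until `_holds` theorems land (printed proofs: p. 428 l. −6 – p. 429 l. 12, "we can
easily prove").  Print observations recorded (not adjudicated): p. 422 l. 9 reads "the vertices (1.4) and (1.15)" where (2.1) and
p. 423 read "(1.14) and (1.15)" (typed: (1.14)); the equation number (2.15) is used twice (p. 427 and p. 428).  Unit
`lit-balaban-r15` (reader/typer r15).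
-/

namespace Literature.MathematicalPhysics.QuantumFieldTheory.Balaban1983to89.B3Sect2Statements

open Finset

/-! ## (2.1): the degree of a vertex -/

/-- The elements of a vertex entering the degree (2.1), p. 422 [PDF 12], verbatim: *"We will define a notion of degree of a vertex
in a given graph G. It is a sum of dimensions of elements forming the vertex. We assume that the dimension of a leg of scalar or
vector field is equal to −(d−2)/2, with the exception of legs of vector fields in the vertices (1.4) [sic; (1.14)] and (1.15) for
which we assume that the dimension is −(d−2)/2 + 1. A dimension of differentiation is −1, each factor η has a dimension +1 and
external fields have a dimension equal to 0."*  Fields: the number of factors η (an integer: the catalogue prints exponents such as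
n + n′ − 1), of scalar legs φ′, of legs of the fluctuation field A′, of lattice differentiations, and whether the vertex "is of the
form (1.14) and (1.15)"; legs of the external field Ã are external fields (dimension 0) and are not counted.
[cite: Balaban1983Higgs3, (2.1) p.422] -/
structure VertexCounts where
  /-- number of factors η (each of dimension +1) -/
  eta : ℤ
  /-- number of scalar-field legs φ′ -/
  scalarLegs : ℕ
  /-- number of legs of the vector field A′ -/
  vectorLegs : ℕ
  /-- number of differentiations -/
  diffs : ℕ
  /-- the vertex is of the form (1.14)–(1.15) -/
  averaging : Bool
  deriving DecidableEq

/-- Which elements of a vertex v belong to internal lines of the graph G, p. 422 (2.1): the numbers of scalar legs, of A′-legs and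
of differentiations of v "belonging to internal lines of the graph G" / "acting on internal lines of the graph G", each at most the
corresponding total. [cite: Balaban1983Higgs3, (2.1) p.422] -/
structure Incidence (c : VertexCounts) where
  /-- scalar legs of v on internal lines of G -/
  intScalar : ℕ
  /-- A′-legs of v on internal lines of G -/
  intVector : ℕ
  /-- differentiations of v acting on internal lines of G -/
  intDiffs : ℕ
  hScalar : intScalar ≤ c.scalarLegs
  hVector : intVector ≤ c.vectorLegs
  hDiffs : intDiffs ≤ c.diffs

/-- The incidence "G contains all the elements of the vertex v" (p. 423 l. 1–2), used to define D(v). [cite: Balaban1983Higgs3, p.423] -/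
def Incidence.full (c : VertexCounts) : Incidence c :=
  ⟨c.scalarLegs, c.vectorLegs, c.diffs, le_rfl, le_rfl, le_rfl⟩

/-- **(2.1)** p. 422 [PDF 12], verbatim: *"We define a degree D_G(v) of a vertex v in a graph G in the following way: D_G(v) = (the
number of factors η in v) + (the number of legs of scalar or vector fields in v belonging to internal lines of the graph G)·(−d+2)/2
− (the number of differentiations in v acting on internal lines of the graph G) + [the number of legs of vector fields in v belonging
to internal lines of the graph G in the case when v is a vertex of the form (1.14) and (1.15)]. (2.1)"* — valued in ℚ (degrees are
half-integers for odd d). [cite: Balaban1983Higgs3, (2.1) p.422] -/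
def degreeIn (d : ℕ) (c : VertexCounts) (i : Incidence c) : ℚ :=
  (c.eta : ℚ) + ((i.intScalar + i.intVector : ℕ) : ℚ) * ((2 - (d : ℚ)) / 2) - (i.intDiffs : ℚ)
    + (if c.averaging then (i.intVector : ℚ) else 0)

/-- D(v), p. 423 [PDF 13] l. 1–2, verbatim: *"Also we define a degree D(v) of a vertex v in the same way as above assuming that G
contains all the elements of the vertex v."* [cite: Balaban1983Higgs3, p.423] -/
def degree (d : ℕ) (c : VertexCounts) : ℚ :=
  degreeIn d c (Incidence.full c)

/-- kernel: unfolding of D(v). [cite: Balaban1983Higgs3, p.423] -/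
theorem degree_eq (d : ℕ) (c : VertexCounts) :
    degree d c = (c.eta : ℚ) + ((c.scalarLegs + c.vectorLegs : ℕ) : ℚ) * ((2 - (d : ℚ)) / 2) - (c.diffs : ℚ)
      + (if c.averaging then (c.vectorLegs : ℚ) else 0) := rfl

/-! ## The printed table (i)–(v), p. 423, kernel-checked from the counts of the catalogue (1.6)–(1.15) -/

/-- Counts of the vertex (1.6) (−λ(L^kε)Σ_{x∈Ω₁}η^d|φ′(x)|⁴): η^d, 4 scalar legs. [cite: Balaban1983Higgs3, (1.6) p.413] -/
def counts16 (d : ℕ) : VertexCounts := ⟨d, 4, 0, 0, false⟩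

/-- Counts of the vertex (1.7) (−½Σ_{x∈Ω₁}η^dδm_i²(x)(L^kε)²|φ′(x)|²): η^d, 2 scalar legs. [cite: Balaban1983Higgs3, (1.7) p.413] -/
def counts17 (d : ℕ) : VertexCounts := ⟨d, 2, 0, 0, false⟩

/-- Counts of the vertices (1.8) (n, n′) and, with n′ = n̄ + 1, of the R-vertices (1.9): η^d·η^{n+n′−1}, 2 scalar legs, n legs of
A′, one differentiation D^η_B̃. [cite: Balaban1983Higgs3, (1.8)–(1.9) p.413] -/
def counts18 (d n n' : ℕ) : VertexCounts := ⟨(d : ℤ) + n + n' - 1, 2, n, 1, false⟩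

/-- Counts of the vertices (1.10) (n, n′) and, with n′ = n̄ + 1, of the R-vertices (1.11): η^d·η^{n+n′−2}, 2 scalar legs, n legs of
A′, no differentiation. [cite: Balaban1983Higgs3, (1.10)–(1.11) p.413] -/
def counts110 (d n n' : ℕ) : VertexCounts := ⟨(d : ℤ) + n + n' - 2, 2, n, 0, false⟩

/-- Counts of the vertices (1.13) (n = n′ = 0), (1.14) (n, n′) and (1.15) (n, n̄+1): η^d, 1 scalar leg, n legs of A′ (of the
averaged form A′(Γ^{(k)}_{y,x}), flag `averaging`), no differentiation. [cite: Balaban1983Higgs3, (1.13)–(1.15) pp.413–414] -/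
def counts1315 (d n : ℕ) : VertexCounts := ⟨d, 1, n, 0, true⟩

/-- **(i)** p. 423 [PDF 13], verbatim: *"if v₁ is the vertex (1.6), then D(v₁) = d + 4·(−d+2)/2 = 4 − d"*.
[cite: Balaban1983Higgs3, p.423 (i)] -/
theorem degree_v16 (d : ℕ) : degree d (counts16 d) = 4 - (d : ℚ) := by
  simp [degree, degreeIn, Incidence.full, counts16]; ring

/-- **(ii)** p. 423 [PDF 13], verbatim: *"if v₂ is the vertex (1.7), then D(v) = d + 2·(−d+2)/2 = 2, but generally we have to take
into account a degree of mass renormalization counterterm (this will be explained later)"*. [cite: Balaban1983Higgs3, p.423 (ii)] -/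
theorem degree_v17 (d : ℕ) : degree d (counts17 d) = 2 := by
  simp [degree, degreeIn, Incidence.full, counts17]; ring

/-- **(iii)** p. 423 [PDF 13], verbatim: *"if v₃ is one of the vertices (1.8) and (1.9), then D(v₃) = d + n + n′ − 1 + (2+n)(−d+2)/2 − 1
= n(4−d)/2 + n′, n + n′ ≥ 1, n ≤ n̄, n′ ≤ n̄ + 1"*. [cite: Balaban1983Higgs3, p.423 (iii)] -/
theorem degree_v18 (d n n' : ℕ) : degree d (counts18 d n n') = (n : ℚ) * ((4 - (d : ℚ)) / 2) + n' := by
  simp [degree, degreeIn, Incidence.full, counts18]; ring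

/-- **(iv)** p. 423 [PDF 13], verbatim: *"if v₄ is one of the vertices (1.10) and (1.11), then D(v₄) = d + n + n′ − 2 + (2+n)(−d+2)/2
= n(4−d)/2 + n′, n + n′ ≥ 2, n ≤ n̄, n′ ≤ n̄ + 1"*. [cite: Balaban1983Higgs3, p.423 (iv)] -/
theorem degree_v110 (d n n' : ℕ) : degree d (counts110 d n n') = (n : ℚ) * ((4 - (d : ℚ)) / 2) + n' := by
  simp [degree, degreeIn, Incidence.full, counts110]; ring

/-- **(v)** p. 423 [PDF 13], verbatim: *"(1.12) has only an external scalar field and for v₅ of the form (1.13)–(1.15) we have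
D(v₅) = d + (n+1)(−d+2)/2 + n = (d+2)/2 + n(4−d)/2, 0 ≤ n ≤ n̄."* [cite: Balaban1983Higgs3, p.423 (v)] -/
theorem degree_v1315 (d n : ℕ) : degree d (counts1315 d n) = ((d : ℚ) + 2) / 2 + (n : ℚ) * ((4 - (d : ℚ)) / 2) := by
  simp [degree, degreeIn, Incidence.full, counts1315]; ring

/-- p. 423 [PDF 13], verbatim: *"Thus for all vertices we have D(v) ≥ (4−d)/2."* — kernel-checked for the catalogue in dimensions
2 ≤ d ≤ 4 under the printed side conditions ((1.8)/(1.9): n + n′ ≥ 1; (1.10)/(1.11): n + n′ ≥ 2).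
[cite: Balaban1983Higgs3, p.423] -/
theorem degree_ge (d : ℕ) (hd2 : 2 ≤ d) (hd4 : d ≤ 4) :
    (4 - (d : ℚ)) / 2 ≤ degree d (counts16 d) ∧ (4 - (d : ℚ)) / 2 ≤ degree d (counts17 d) ∧
    (∀ n n' : ℕ, 1 ≤ n + n' → (4 - (d : ℚ)) / 2 ≤ degree d (counts18 d n n')) ∧
    (∀ n n' : ℕ, 2 ≤ n + n' → (4 - (d : ℚ)) / 2 ≤ degree d (counts110 d n n')) ∧
    (∀ n : ℕ, (4 - (d : ℚ)) / 2 ≤ degree d (counts1315 d n)) := by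
  have hd2' : (2 : ℚ) ≤ d := by exact_mod_cast hd2
  have hd4' : (d : ℚ) ≤ 4 := by exact_mod_cast hd4
  refine ⟨?_, ?_, ?_, ?_, ?_⟩
  · rw [degree_v16]; linarith
  · rw [degree_v17]; linarith
  · intro n n' h
    rw [degree_v18]
    have h' : (1 : ℚ) ≤ n + n' := by exact_mod_cast h
    rcases Nat.eq_zero_or_pos n with hn | hn
    · subst hn
      have : (1 : ℚ) ≤ n' := by simpa using h'
      simp; linarith
    · have hn' : (1 : ℚ) ≤ n := by exact_mod_cast hn
      have : (0 : ℚ) ≤ n' := by positivity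
      nlinarith
  · intro n n' h
    rw [degree_v110]
    have h' : (2 : ℚ) ≤ n + n' := by exact_mod_cast h
    rcases Nat.eq_zero_or_pos n with hn | hn
    · subst hn
      have : (2 : ℚ) ≤ n' := by simpa using h'
      simp; linarith
    · have hn' : (1 : ℚ) ≤ n := by exact_mod_cast hn
      have : (0 : ℚ) ≤ n' := by positivity
      nlinarith
  · intro n
    rw [degree_v1315]
    have : (0 : ℚ) ≤ n := by positivity
    nlinarith

/-- p. 423 [PDF 13], verbatim: *"Of course we have also D_G(v) ≥ D(v), except for the vertices (1.14) and (1.15)."* — kernel-checked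
for every vertex NOT of the form (1.14)–(1.15) in dimension d ≥ 2: making legs external raises the count (each leg has dimension
−(d−2)/2 ≤ 0) and removing differentiations from internal lines raises it. [cite: Balaban1983Higgs3, p.423] -/
theorem degree_le_degreeIn (d : ℕ) (hd : 2 ≤ d) (c : VertexCounts) (hc : c.averaging = false) (i : Incidence c) :
    degree d c ≤ degreeIn d c i := by
  have hd' : (2 : ℚ) ≤ d := by exact_mod_cast hd
  have h1 : ((i.intScalar + i.intVector : ℕ) : ℚ) ≤ ((c.scalarLegs + c.vectorLegs : ℕ) : ℚ) := by
    exact_mod_cast Nat.add_le_add i.hScalar i.hVector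
  have h2 : (i.intDiffs : ℚ) ≤ (c.diffs : ℚ) := by exact_mod_cast i.hDiffs
  have h3 : (2 - (d : ℚ)) / 2 ≤ 0 := by linarith
  simp only [degree, degreeIn, Incidence.full, hc, Bool.false_eq_true, if_false, add_zero]
  nlinarith [mul_le_mul_of_nonpos_right h1 h3]

/-- The printed exception, WITNESSED: for a vertex of the form (1.14) with one A′-leg in d = 3, the incidence with that leg external
has D_G(v) = 3 < 7/2 = D(v) (the leg contributes −(d−2)/2 + 1 = +1/2 > 0 when internal).  Kernel fact about the definition (2.1);
it is the reason for the printed clause "except for the vertices (1.14) and (1.15)". [cite: Balaban1983Higgs3, p.423] -/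
theorem degreeIn_lt_degree_averaging :
    degreeIn 3 (counts1315 3 1) ⟨1, 0, 0, le_rfl, Nat.zero_le _, le_rfl⟩ < degree 3 (counts1315 3 1) := by
  simp [degree, degreeIn, Incidence.full, counts1315]; norm_num

/-! ## (2.2)–(2.3): the degree of a connected graph -/

/-- A vertex of a graph with its incidence data and the degree of the mass renormalization counterterm attached to it ((2.3): 0
unless the vertex is (1.7) carrying a counterterm from δm²_k, in which case "a degree of this counterterm [is] the degree of the
graph G₀" it corresponds to; the counterterms from δm²_fin, δm²_{K,k} have degree 0, p. 423). [cite: Balaban1983Higgs3, (2.3) p.423] -/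
structure GraphVertex where
  /-- the counts of the vertex -/
  counts : VertexCounts
  /-- its incidence in G -/
  inc : Incidence counts
  /-- degree of the mass renormalization counterterm connected with the vertex (0 if none) -/
  ctDeg : ℚ

/-- **(2.2)–(2.3)** p. 423 [PDF 13], verbatim: *"if a graph G does not have the vertices of the form (1.7) (mass renormalization
vertices), then we define D(G) = Σ_{v∈G} D_G(v) − d. (2.2) We take the same definition in the case when mass renormalization
counterterms are given by the terms of the first two expressions on the right side of (1.29), i.e. δm²_fin or δm²_{K,k}. We will say
also that the degrees of these counterterms are equal to 0. If we have a counterterm from δm_k², then it corresponds to some graph G₀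
and we define a degree of this counterterm as the degree of the graph G₀. … In the general case we take the following definition,
which in fact is an inductive definition: D(G) = Σ_{v∈G} D_G(v) − d + (a sum of degrees of mass renormalization counterterms connected
with the vertices of the graph G). (2.3) Thus the degree of G is the same as the degree of a graph G′ obtained from G by attaching
the corresponding graphs to the mass renormalization vertices."* — for a connected graph given as a finite family of vertices with
incidence data; the inductive clause is realised by the field `ctDeg`. [cite: Balaban1983Higgs3, (2.2)–(2.3) p.423] -/
def graphDegree (d : ℕ) {ι : Type} (V : Finset ι) (vx : ι → GraphVertex) : ℚ :=
  (∑ v ∈ V, degreeIn d (vx v).counts (vx v).inc) - (d : ℚ) + ∑ v ∈ V, (vx v).ctDeg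

/-- kernel: with all counterterm degrees 0, (2.3) is (2.2). [cite: Balaban1983Higgs3, (2.2) p.423] -/
theorem graphDegree_eq_22 (d : ℕ) {ι : Type} (V : Finset ι) (vx : ι → GraphVertex) (h : ∀ v ∈ V, (vx v).ctDeg = 0) :
    graphDegree d V vx = (∑ v ∈ V, degreeIn d (vx v).counts (vx v).inc) - (d : ℚ) := by
  rw [graphDegree, Finset.sum_eq_zero h, add_zero]

/-- **(2.4)** p. 424 [PDF 14], verbatim: *"let us introduce the following special graph with a degree equal to 0: [picture (2.4): two
vertices of the (1.8)-type ((1.17): "the vertices (1.8) or (1.9)"), each carrying one external scalar leg and one external vector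
leg, joined by a single scalar line]"*.  Kernel-checked READING under which the printed "degree equal to 0" holds for every d: both
vertices have the counts of (1.8) with n + n′ = 1, exactly one scalar leg of each lies on the internal line, no A′-leg is internal,
and the differentiation D^η_B̃ of EACH vertex acts on the internal line (with a differentiation on an external leg the same formula
gives 1, resp. 2).  The identification of the picture with these incidences is a reading (referee F6), recorded in SKELETON row
B3-14. [cite: Balaban1983Higgs3, (2.4) p.424] -/
theorem degree_graph24 (d n n' : ℕ) (h : n + n' = 1) :
    graphDegree d (Finset.univ : Finset (Fin 2))
      (fun _ => ⟨counts18 d n n', ⟨1, 0, 1, by simp [counts18], Nat.zero_le _, by simp [counts18]⟩, 0⟩) = 0 := by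
  have h' : (n : ℚ) + n' = 1 := by exact_mod_cast h
  simp [graphDegree, degreeIn, counts18]
  linear_combination (2 : ℚ) * h'

/-! ## The summation step of p. 427 -/

/-- p. 427 [PDF 17], verbatim: *"Now it is easy to see that the remaining powers of L^jη connected with the graph G₁ give us
(L^jη)^{D(G₁)}. Because D(G₁) > 0 we can make the summation over j and this gives us Σ_{j=0}^{j_{l(2)}} (L^jη)^{D(G₁)} ≤
O(1)(L^{j_{l(2)}}η)^{D(G₁)}."* — kernel-checked with the explicit constant O(1) = (1 − L^{−D})^{−1} (depending on L and D only), for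
real L > 1, η ≥ 0, D > 0 and every J. [cite: Balaban1983Higgs3, p.427] -/
theorem sum_scalePow_le (L η D : ℝ) (hL : 1 < L) (hη : 0 ≤ η) (hD : 0 < D) (J : ℕ) :
    ∑ j ∈ Finset.range (J + 1), (L ^ j * η) ^ D ≤ (1 - L ^ (-D))⁻¹ * (L ^ J * η) ^ D := by
  have hL0 : 0 < L := by linarith
  set r : ℝ := L ^ D with hr
  have hr1 : 1 < r := Real.one_lt_rpow hL hD
  have hr0 : 0 < r := by linarith
  -- (L^j η)^D = η^D r^j
  have hterm : ∀ j : ℕ, (L ^ j * η) ^ D = η ^ D * r ^ j := by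
    intro j
    rw [Real.mul_rpow (pow_nonneg hL0.le j) hη, hr, ← Real.rpow_natCast L j, ← Real.rpow_mul hL0.le,
      ← Real.rpow_natCast (L ^ D) j, ← Real.rpow_mul hL0.le, mul_comm (j : ℝ) D]
    ring
  simp_rw [hterm, ← Finset.mul_sum]
  -- geometric sum
  have hgeom : ∑ j ∈ Finset.range (J + 1), r ^ j = (r ^ (J + 1) - 1) / (r - 1) := geom_sum_eq hr1.ne' (J + 1)
  rw [hgeom]
  have hne : r - 1 ≠ 0 := by linarith
  have hkey : (r ^ (J + 1) - 1) / (r - 1) ≤ (1 - L ^ (-D))⁻¹ * r ^ J := by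
    have hLD : L ^ (-D) = r⁻¹ := by rw [Real.rpow_neg hL0.le, hr]
    rw [hLD]
    have h1 : (1 - r⁻¹)⁻¹ * r ^ J = r ^ (J + 1) / (r - 1) := by
      field_simp
      ring
    rw [h1, div_le_div_iff_of_pos_right (by linarith)]
    linarith
  have hηD : 0 ≤ η ^ D := Real.rpow_nonneg hη D
  calc η ^ D * ((r ^ (J + 1) - 1) / (r - 1)) ≤ η ^ D * ((1 - L ^ (-D))⁻¹ * r ^ J) :=
        mul_le_mul_of_nonneg_left hkey hηD
    _ = (1 - L ^ (-D))⁻¹ * (η ^ D * r ^ J) := by ring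

/-! ## (2.17) and Corollary 2.3 over an abstract family of graphs -/

/-- Abstract carrier for (2.17) and Corollary 2.3: the graphs of the expansion with the printed quantities — number of vertices,
number of external legs, the degree D(G) of (2.2)–(2.3) — and the three printed vertex predicates.  Carrier clauses (F6): what a
graph is (p. 415), which vertices it is built of, and the computation of `degree` from (2.1)–(2.3) (`graphDegree` above) are data
of the instance. [cite: Balaban1983Higgs3, (2.17) p.429] -/
structure GraphFamily where
  /-- the graphs -/
  Graph : Type
  /-- number of vertices -/
  numVertices : Graph → ℕ
  /-- number of external legs -/
  numExtLegs : Graph → ℕ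
  /-- D(G), (2.2)–(2.3) -/
  degree : Graph → ℚ
  /-- "G has a vertex of the form (1.13)–(1.15)" -/
  hasVertex1315 : Graph → Prop
  /-- "G has an R-vertex" ((1.9), (1.11), (1.15)) -/
  hasRVertex : Graph → Prop
  /-- "G has a vertex (1.7) with finite counterterms" (δm²_fin, δm²_{K,k}) -/
  hasFiniteCounterterm : Graph → Prop

/-- **(2.17)** p. 429 [PDF 19], verbatim: *"For the graphs G which do not contain vertices of the form (1.13)–(1.15) we can easily
prove the following estimate D(G) ≥ −2(d−2)/2 − 1 + ((a number of vertices) − 1)(4−d)/2 + ((a number of external legs) − 1)(d−2)/2,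
(2.17)"* — for the family in dimension `d`; "easily prove": no printed proof. [cite: Balaban1983Higgs3, (2.17) p.429] -/
def Ineq217 (d : ℕ) (F : GraphFamily) : Prop :=
  ∀ G : F.Graph, ¬ F.hasVertex1315 G →
    -2 * (((d : ℚ) - 2) / 2) - 1 + ((F.numVertices G : ℚ) - 1) * ((4 - (d : ℚ)) / 2)
        + ((F.numExtLegs G : ℚ) - 1) * (((d : ℚ) - 2) / 2) ≤ F.degree G

/-- **Corollary 2.3** p. 429 [PDF 19], verbatim: *"If a graph G has a vertex of the form (1.13)–(1.15), or an R-vertex, or a vertex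
(1.7) with finite counterterms, or it has more than four external legs, then D(G) > 0."*  Printed justification (pp. 428–429): the
case analysis for vertices (1.13)–(1.15), "it is easy to notice that if a graph G has an R-vertex of the form (1.9) and (1.11), then it
has positive degree", and (2.17) "from which it follows that the graphs with more than four external legs have positive degree in
d = 3. In d = 2 graphs are more convergent, so degrees are still positive" — typed for the family in its dimension; NO printed proof
beyond these sentences. [cite: Balaban1983Higgs3, Cor. 2.3 p.429] -/
def Cor23 (F : GraphFamily) : Prop :=
  ∀ G : F.Graph, (F.hasVertex1315 G ∨ F.hasRVertex G ∨ F.hasFiniteCounterterm G ∨ 4 < F.numExtLegs G) → 0 < F.degree G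

/-- kernel: the right side of (2.17) in d = 3 equals ((number of vertices) + (number of external legs) − 6)/2; hence (2.17) yields
D(G) > 0 whenever V + E ≥ 7 — in particular for E ≥ 5 external legs and V ≥ 2 vertices (the printed use "graphs with more than four
external legs have positive degree in d = 3"; for a one-vertex graph with five external legs (2.17) alone gives only D(G) ≥ 0).
[cite: Balaban1983Higgs3, (2.17) p.429] -/
theorem rhs217_d3 (V E : ℕ) :
    -2 * (((3 : ℕ) : ℚ) - 2) / 2 - 1 + ((V : ℚ) - 1) * ((4 - ((3 : ℕ) : ℚ)) / 2) + ((E : ℚ) - 1) * ((((3 : ℕ) : ℚ) - 2) / 2)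
      = ((V : ℚ) + E - 6) / 2 := by
  push_cast; ring

/-- kernel: (2.17) in d = 3 gives D(G) > 0 for every graph without vertices (1.13)–(1.15) having V vertices and E external legs with
V + E ≥ 7. [cite: Balaban1983Higgs3, Cor. 2.3 p.429] -/
theorem degree_pos_of_217_d3 (F : GraphFamily) (h217 : Ineq217 3 F) (G : F.Graph) (hG : ¬ F.hasVertex1315 G)
    (hVE : 7 ≤ F.numVertices G + F.numExtLegs G) : 0 < F.degree G := by
  have h := h217 G hG
  have h7 : (7 : ℚ) ≤ (F.numVertices G : ℚ) + (F.numExtLegs G : ℚ) := by exact_mod_cast hVE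
  have e : -2 * ((((3 : ℕ) : ℚ)) - 2) / 2 - 1 + ((F.numVertices G : ℚ) - 1) * ((4 - ((3 : ℕ) : ℚ)) / 2)
      + ((F.numExtLegs G : ℚ) - 1) * ((((3 : ℕ) : ℚ) - 2) / 2) = ((F.numVertices G : ℚ) + F.numExtLegs G - 6) / 2 :=
    rhs217_d3 _ _
  have h' : ((F.numVertices G : ℚ) + F.numExtLegs G - 6) / 2 ≤ F.degree G := by
    have := h
    push_cast at this e ⊢
    linarith
  linarith

end Literature.MathematicalPhysics.QuantumFieldTheory.Balaban1983to89.B3Sect2Statements
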